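import Literature.Geometry.GeometricMeasureTheory.RadialDensityTauberian
import HarnessLib

/-!
# The Lelong–Jensen identity: exact mass ratios from the profile-invariance of Monge–Ampère functionals

This file sharpens the Tauberian theorem of `RadialDensityTauberian.lean`
(`Literature.Geometry.GeometricMeasureTheory.tendsto_measure_div_pow_of_profile_invariance`:
the mass ratios `μ{rad < r}/r^{2p}` CONVERGE to `L - W` as `r → 0⁺`) to an EXACT identity, under
the very same hypotheses. Let `μ` be an s-finite measure on `X`, `rad : X → (0, ∞)` and
`σ : X → [0, 1]` measurable, `p ≥ 1`, and suppose that the profile functionals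
`∫ rad^{-2p} (h(log rad)^p (1 - σ) + ½ h^{p-1} h'(log rad) σ) dμ` all equal the same finite `L`
for every profile transition `h` located left of `x₀`. Then for every `0 < r ≤ e^{x₀}`

* `μ{rad < r} + r^{2p} ∫_{rad ≥ r} rad^{-2p} (1 - σ) dμ = r^{2p} L`
  (`measure_lt_add_mul_setLIntegral_eq_of_profile_invariance`), i.e.
* `μ{rad < r} / r^{2p} = L - ∫_{rad ≥ r} rad^{-2p} (1 - σ) dμ`
  (`measure_lt_div_pow_eq_of_profile_invariance`);

consequently the mass ratio `r ↦ μ{rad < r}/r^{2p}` is **monotone non-decreasing** on `(0, e^{x₀}]`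
(`monotoneOn_measure_lt_div_pow_of_profile_invariance`) and bounded below by its limit `L - W`,
`W = ∫ rad^{-2p}(1 - σ) dμ` (`sub_le_measure_lt_div_pow_of_profile_invariance`). For
`μ = 𝓗^{2p} ⌞ A`, `A` an analytic set of pure dimension `p` through `a`, `rad = ‖· - a‖` and `σ` the
tangential fraction, this is the Lelong–Jensen formula
`vol A_r = n(A,a) c(p) r^{2p} + r^{2p} ∫_{A_r} ω₀ᵖ/p!` of [Chirka1989, §15.1 (∗)] (equivalently
[Demailly, *Complex analytic and differential geometry*, Ch. III (5.5)–(5.6)]) and the monotonicity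
of the mass ratio [Chirka1989, §15.1 Prop. 1]; the geometric assembly is
`Literature/Geometry/Kaehler/LelongMonotonicity.lean`.

## Proof

Fix a transition `h` at `0` of scale `ε` and a level `λ₀` with `λ₀ + ε ≤ x₀`. The hypothesis for
the translates `h(· - s)`, `s ≤ λ₀`, is integrated against the weight `2p e^{2ps} ds` over
`(-∞, λ₀]`; by Tonelli this gives
`∫ (rad^{-2p}(1 - σ) P(log rad) + rad^{-2p} σ Q(log rad)) dμ = e^{2pλ₀} L` with the inner integrals
`P(y) = ∫_{s ≤ λ₀} 2p e^{2ps} h(y - s)^p ds` and `Q(y) = ∫_{s ≤ λ₀} 2p e^{2ps} ½h^{p-1}h'(y - s) ds`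
(`lintegral_inner_eq_exp_mul_of_profile_invariance`). Since `h(· - s)` passes from `0` to `1` on
`[s - ε, s + ε]` and the kernel has mass `1/(2p)` there, `P(y)` and `Q(y)` are both sandwiched
between `e^{2p(y ∓ ε)}` below the level and `P = e^{2pλ₀}`, `Q = 0` above it; with
`rad^{-2p} e^{2p log rad} = 1` this yields
`e^{-2pε} μ{log rad ≤ λ₀ - ε} + e^{2pλ₀} ∫_{log rad ≥ λ₀+ε} rad^{-2p}(1-σ) ≤ e^{2pλ₀} L ≤
 e^{2pε} μ{log rad < λ₀ + ε} + e^{2pλ₀} ∫_{log rad ≥ λ₀+ε} rad^{-2p}(1-σ)`.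
Taking `λ₀ = x - ε` and letting `ε → 0⁺` (continuity of `μ` from below on the left-hand side) gives
the identity at `r = e^x`. No Stokes theorem with boundary and no null-sphere lemma is needed.

Theorems only; imports `RadialDensityTauberian.lean`.

## References

* E. M. Chirka, *Complex Analytic Sets*, Kluwer 1989, §15.1 Prop. 1 and formula (∗), p. 189
  [Chirka1989].
* J.-P. Demailly, *Complex analytic and differential geometry*, Ch. III §5 (5.5)–(5.6).
-/

noncomputable section

open Set Filter MeasureTheory intervalIntegral Real
open scoped Topology ENNReal

namespace Literature.Geometry.GeometricMeasureTheory

variable {X : Type*} {rad σ : X → ℝ} {p : ℕ} {x₀ : ℝ} {L : ℝ≥0∞}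

/-! ### The exponential weight `2p e^{2ps} ds` -/

section ExpWeight

/-- `∫_{λ₁}^{λ₀} k e^{ks} ds = e^{kλ₀} - e^{kλ₁}` in `ℝ≥0∞` (`k > 0`). [folklore] -/
private theorem lintegral_Icc_mul_exp {k : ℝ} (hk : 0 < k) {l₁ l₀ : ℝ} (hl : l₁ ≤ l₀) :
    ∫⁻ s in Icc l₁ l₀, ENNReal.ofReal (k * exp (k * s)) =
      ENNReal.ofReal (exp (k * l₀) - exp (k * l₁)) := by
  have hcont : Continuous fun s : ℝ => k * exp (k * s) := by fun_prop
  rw [← ofReal_integral_eq_lintegral_ofReal hcont.integrableOn_Icc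
      (ae_of_all _ fun s => by positivity), integral_Icc_eq_integral_Ioc,
    ← intervalIntegral.integral_of_le hl]
  congr 1
  have hderiv : ∀ s ∈ uIcc l₁ l₀, HasDerivAt (fun s => exp (k * s)) (k * exp (k * s)) s := by
    intro s _
    have := ((hasDerivAt_id s).const_mul k).exp
    simpa [mul_comm] using this
  rw [intervalIntegral.integral_eq_sub_of_hasDerivAt hderiv (hcont.intervalIntegrable _ _)]

/-- **`∫_{-∞}^{c} k e^{ks} ds = e^{kc}`** in `ℝ≥0∞` (`k > 0`), by exhaustion of `(-∞, c]` by the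
windows `[c - n, c]`. [cite: Chirka1989, §15.1 (∗)] -/
theorem lintegral_Iic_mul_exp {k : ℝ} (hk : 0 < k) (c : ℝ) :
    ∫⁻ s in Iic c, ENNReal.ofReal (k * exp (k * s)) = ENNReal.ofReal (exp (k * c)) := by
  have hU : Iic c = ⋃ n : ℕ, Icc (c - n) c := by
    ext s
    simp only [mem_Iic, mem_iUnion, mem_Icc]
    constructor
    · intro hs
      obtain ⟨n, hn⟩ := exists_nat_ge (c - s)
      exact ⟨n, by linarith, hs⟩
    · rintro ⟨n, hn⟩
      exact hn.2
  have hmono : Monotone fun n : ℕ => Icc (c - (n : ℝ)) c := fun n m hnm =>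
    Icc_subset_Icc (sub_le_sub_left (Nat.cast_le.2 hnm) c) le_rfl
  rw [hU, setLIntegral_iUnion_of_directed _ hmono.directed_le]
  have heq : ∀ n : ℕ, ∫⁻ s in Icc (c - (n : ℝ)) c, ENNReal.ofReal (k * exp (k * s)) =
      ENNReal.ofReal (exp (k * c) - exp (k * (c - n))) := fun n =>
    lintegral_Icc_mul_exp hk (sub_le_self c n.cast_nonneg)
  simp_rw [heq]
  apply le_antisymm
  · exact iSup_le fun n => ENNReal.ofReal_le_ofReal (sub_le_self _ (exp_pos _).le)
  · have h1 : Tendsto (fun n : ℕ => k * (c - (n : ℝ))) atTop atBot := by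
      have h0 : Tendsto (fun n : ℕ => -(n : ℝ) + c) atTop atBot :=
        tendsto_atBot_add_const_right _ c (tendsto_neg_atTop_atBot.comp tendsto_natCast_atTop_atTop)
      have := h0.const_mul_atBot hk
      refine this.congr fun n => by ring
    have h2 : Tendsto (fun n : ℕ => exp (k * c) - exp (k * (c - (n : ℝ)))) atTop (𝓝 (exp (k * c))) := by
      have := (tendsto_const_nhds (x := exp (k * c))).sub (tendsto_exp_atBot.comp h1)
      rwa [sub_zero] at this
    exact le_of_tendsto' (ENNReal.tendsto_ofReal h2) fun n => le_iSup (fun n : ℕ =>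
      ENNReal.ofReal (exp (k * c) - exp (k * (c - (n : ℝ))))) n

/-- `rad^{-2p} e^{2p(log rad + c)} = e^{2pc}` for `rad > 0`. [folklore] -/
private theorem inv_pow_mul_exp_log_add {r : ℝ} (hr : 0 < r) (c : ℝ) :
    (r ^ (2 * p))⁻¹ * exp ((2 * p) * (log r + c)) = exp ((2 * p) * c) := by
  rw [exp_two_mul_log_add hr, ← mul_assoc, inv_mul_cancel₀ (pow_ne_zero _ hr.ne'), one_mul]

/-- `e^{ct} → 1` as `t → 0⁺`, in `ℝ≥0∞`. [folklore] -/
private theorem tendsto_ofReal_exp_mul_nhdsGT (c : ℝ) :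
    Tendsto (fun t : ℝ => ENNReal.ofReal (exp (c * t))) (𝓝[>] 0) (𝓝 1) := by
  have hc : Continuous fun t : ℝ => exp (c * t) := by fun_prop
  have h1 : Tendsto (fun t : ℝ => exp (c * t)) (𝓝 0) (𝓝 1) := by
    have := hc.tendsto 0
    rwa [mul_zero, exp_zero] at this
  have h2 := ENNReal.tendsto_ofReal (tendsto_nhdsWithin_of_tendsto_nhds (s := Ioi 0) h1)
  rwa [ENNReal.ofReal_one] at h2

end ExpWeight

/-! ### The inner `s`-integrals `P` and `Q` of the weighted translates -/

section Inner

variable {h : ℝ → ℝ} {ε : ℝ}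

/-- `0 < 2p` as a real number, for `p ≥ 1`. [folklore] -/
private theorem two_mul_pos (hp : 1 ≤ p) : (0 : ℝ) < 2 * p := by
  have : (1 : ℝ) ≤ p := by exact_mod_cast hp
  linarith

/-- **`P(y) ≤ e^{2pλ₀}`**: `∫_{s ≤ λ₀} 2p e^{2ps} h(y-s)^p ds ≤ e^{2pλ₀}` (`h ≤ 1`).
[cite: Chirka1989, §15.1 (∗)] -/
theorem lintegral_Iic_weight_mul_pow_le_exp (hh : IsProfileTransition h 0 ε) (hp : 1 ≤ p)
    (l₀ y : ℝ) :
    ∫⁻ s in Iic l₀, ENNReal.ofReal (2 * p * exp (2 * p * s) * h (y - s) ^ p) ≤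
      ENNReal.ofReal (exp (2 * p * l₀)) := by
  have hk := two_mul_pos hp
  calc ∫⁻ s in Iic l₀, ENNReal.ofReal (2 * p * exp (2 * p * s) * h (y - s) ^ p)
      ≤ ∫⁻ s in Iic l₀, ENNReal.ofReal (2 * p * exp (2 * p * s)) :=
        lintegral_mono fun s => ENNReal.ofReal_le_ofReal
          (mul_le_of_le_one_right (by positivity) (pow_le_one₀ (hh.nonneg _) (hh.le_one _)))
    _ = ENNReal.ofReal (exp (2 * p * l₀)) := lintegral_Iic_mul_exp hk l₀

/-- **`P(y) ≤ e^{2p(y+ε)}`**: the translate `h(y - s)` vanishes for `s ≥ y + ε`.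
[cite: Chirka1989, §15.1 (∗)] -/
theorem lintegral_Iic_weight_mul_pow_le_exp_add (hh : IsProfileTransition h 0 ε) (hp : 1 ≤ p)
    (l₀ y : ℝ) :
    ∫⁻ s in Iic l₀, ENNReal.ofReal (2 * p * exp (2 * p * s) * h (y - s) ^ p) ≤
      ENNReal.ofReal (exp (2 * p * (y + ε))) := by
  have hk := two_mul_pos hp
  have hp0 : p ≠ 0 := by omega
  calc ∫⁻ s in Iic l₀, ENNReal.ofReal (2 * p * exp (2 * p * s) * h (y - s) ^ p)
      ≤ ∫⁻ s in Iic l₀, (Iic (y + ε)).indicator (fun s => ENNReal.ofReal (2 * p * exp (2 * p * s))) s := by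
        refine lintegral_mono fun s => ?_
        by_cases hs : s ∈ Iic (y + ε)
        · rw [indicator_of_mem hs]
          exact ENNReal.ofReal_le_ofReal
            (mul_le_of_le_one_right (by positivity) (pow_le_one₀ (hh.nonneg _) (hh.le_one _)))
        · rw [indicator_of_notMem hs, hh.eq_zero_of_le (y - s) (by rw [mem_Iic, not_le] at hs; linarith),
            zero_pow hp0, mul_zero, ENNReal.ofReal_zero]
    _ = ∫⁻ s in Iic l₀ ∩ Iic (y + ε), ENNReal.ofReal (2 * p * exp (2 * p * s)) := by
        rw [lintegral_indicator measurableSet_Iic, Measure.restrict_restrict measurableSet_Iic,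
          inter_comm]
    _ ≤ ∫⁻ s in Iic (y + ε), ENNReal.ofReal (2 * p * exp (2 * p * s)) :=
        lintegral_mono_set inter_subset_right
    _ = ENNReal.ofReal (exp (2 * p * (y + ε))) := lintegral_Iic_mul_exp hk _

/-- **`P(y) = e^{2pλ₀}` above the level**: for `λ₀ ≤ y - ε` the translate equals `1` on `s ≤ λ₀`.
[cite: Chirka1989, §15.1 (∗)] -/
theorem lintegral_Iic_weight_mul_pow_eq_exp_of_le (hh : IsProfileTransition h 0 ε) (hp : 1 ≤ p)
    {l₀ y : ℝ} (hy : l₀ ≤ y - ε) :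
    ∫⁻ s in Iic l₀, ENNReal.ofReal (2 * p * exp (2 * p * s) * h (y - s) ^ p) =
      ENNReal.ofReal (exp (2 * p * l₀)) := by
  have hk := two_mul_pos hp
  rw [← lintegral_Iic_mul_exp hk l₀]
  refine setLIntegral_congr_fun measurableSet_Iic fun s hs => ?_
  rw [hh.eq_one_of_le (y - s) (by rw [mem_Iic] at hs; linarith), one_pow, mul_one]

/-- **`P(y) ≥ e^{2p(y-ε)}` below the level**: for `y - ε ≤ λ₀` the window `s ≤ y - ε`, where the
translate equals `1`, lies inside `s ≤ λ₀`. [cite: Chirka1989, §15.1 (∗)] -/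
theorem exp_sub_le_lintegral_Iic_weight_mul_pow (hh : IsProfileTransition h 0 ε) (hp : 1 ≤ p)
    {l₀ y : ℝ} (hy : y - ε ≤ l₀) :
    ENNReal.ofReal (exp (2 * p * (y - ε))) ≤
      ∫⁻ s in Iic l₀, ENNReal.ofReal (2 * p * exp (2 * p * s) * h (y - s) ^ p) := by
  have hk := two_mul_pos hp
  calc ENNReal.ofReal (exp (2 * p * (y - ε)))
      = ∫⁻ s in Iic (y - ε), ENNReal.ofReal (2 * p * exp (2 * p * s)) := (lintegral_Iic_mul_exp hk _).symm
    _ = ∫⁻ s in Iic (y - ε), ENNReal.ofReal (2 * p * exp (2 * p * s) * h (y - s) ^ p) := by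
        refine setLIntegral_congr_fun measurableSet_Iic fun s hs => ?_
        rw [hh.eq_one_of_le (y - s) (by rw [mem_Iic] at hs; linarith), one_pow, mul_one]
    _ ≤ ∫⁻ s in Iic l₀, ENNReal.ofReal (2 * p * exp (2 * p * s) * h (y - s) ^ p) :=
        lintegral_mono_set (Iic_subset_Iic.2 hy)

/-- The total mass of the translated kernel: `∫_{y-ε}^{y+ε} ½h^{p-1}h'(y - s) ds = 1/(2p)`.
[folklore] -/
private theorem lintegral_Icc_kernel_eq_inv (hh : IsProfileTransition h 0 ε) (hp : 1 ≤ p) (hε : 0 < ε)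
    (y : ℝ) :
    ∫⁻ s in Icc (y - ε) (y + ε), ENNReal.ofReal (profileKernel h p (y - s)) =
      ENNReal.ofReal (1 / (2 * p)) := by
  rw [lintegral_Icc_kernel_eq hh hp (by linarith) y, sub_sub_cancel, sub_add_cancel_left,
    hh.eq_one_of_le ε (by linarith), hh.eq_zero_of_le (-ε) (by linarith), one_pow,
    zero_pow (by omega), zero_div, sub_zero]

/-- The weighted translated kernel vanishes off the window `[y - ε, y + ε]`. [folklore] -/
private theorem weight_mul_kernel_eq_indicator (hh : IsProfileTransition h 0 ε) (hε : 0 < ε) (y s : ℝ) :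
    ENNReal.ofReal (2 * p * exp (2 * p * s) * profileKernel h p (y - s)) =
      (Icc (y - ε) (y + ε)).indicator
        (fun s => ENNReal.ofReal (2 * p * exp (2 * p * s) * profileKernel h p (y - s))) s := by
  by_cases hs : s ∈ Icc (y - ε) (y + ε)
  · rw [indicator_of_mem hs]
  · rw [indicator_of_notMem hs, hh.profileKernel_eq_zero_of_lt_abs p, mul_zero, ENNReal.ofReal_zero]
    rw [mem_Icc, not_and_or, not_le, not_le] at hs
    rw [sub_zero]
    rcases hs with hs | hs
    · rw [abs_of_nonneg (by linarith)]; linarith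
    · rw [abs_of_nonpos (by linarith)]; linarith

/-- **`Q(y) ≤ e^{2p(y+ε)}`**: `∫_{s ≤ λ₀} 2p e^{2ps} ½h^{p-1}h'(y - s) ds ≤ e^{2p(y+ε)}` (the kernel
lives on `|y - s| ≤ ε` and has mass `1/(2p)`). [cite: Chirka1989, §15.1 (∗)] -/
theorem lintegral_Iic_weight_mul_kernel_le_exp_add (hh : IsProfileTransition h 0 ε) (hp : 1 ≤ p)
    (hε : 0 < ε) (l₀ y : ℝ) :
    ∫⁻ s in Iic l₀, ENNReal.ofReal (2 * p * exp (2 * p * s) * profileKernel h p (y - s)) ≤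
      ENNReal.ofReal (exp (2 * p * (y + ε))) := by
  have hk := two_mul_pos hp
  calc ∫⁻ s in Iic l₀, ENNReal.ofReal (2 * p * exp (2 * p * s) * profileKernel h p (y - s))
      ≤ ∫⁻ s, ENNReal.ofReal (2 * p * exp (2 * p * s) * profileKernel h p (y - s)) :=
        lintegral_mono' Measure.restrict_le_self le_rfl
    _ = ∫⁻ s in Icc (y - ε) (y + ε),
          ENNReal.ofReal (2 * p * exp (2 * p * s) * profileKernel h p (y - s)) := by
        rw [← lintegral_indicator measurableSet_Icc]
        exact lintegral_congr fun s => weight_mul_kernel_eq_indicator hh hε y s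
    _ ≤ ∫⁻ s in Icc (y - ε) (y + ε),
          ENNReal.ofReal (2 * p * exp (2 * p * (y + ε))) * ENNReal.ofReal (profileKernel h p (y - s)) := by
        refine setLIntegral_mono' measurableSet_Icc fun s hs => ?_
        rw [← ENNReal.ofReal_mul (by positivity)]
        refine ENNReal.ofReal_le_ofReal (mul_le_mul_of_nonneg_right ?_ (hh.profileKernel_nonneg p _))
        exact mul_le_mul_of_nonneg_left (exp_le_exp.2 (by nlinarith [hs.2])) hk.le
    _ = ENNReal.ofReal (2 * p * exp (2 * p * (y + ε))) * ENNReal.ofReal (1 / (2 * p)) := by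
        rw [lintegral_const_mul' _ _ ENNReal.ofReal_ne_top, lintegral_Icc_kernel_eq_inv hh hp hε]
    _ = ENNReal.ofReal (exp (2 * p * (y + ε))) := by
        rw [← ENNReal.ofReal_mul (by positivity)]
        congr 1
        field_simp

/-- **`Q(y) = 0` above the level**: for `λ₀ ≤ y - ε` the kernel `½h^{p-1}h'(y - s)` vanishes on
`s ≤ λ₀`. [cite: Chirka1989, §15.1 (∗)] -/
theorem lintegral_Iic_weight_mul_kernel_eq_zero_of_le (hh : IsProfileTransition h 0 ε)
    {l₀ y : ℝ} (hy : l₀ ≤ y - ε) :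
    ∫⁻ s in Iic l₀, ENNReal.ofReal (2 * p * exp (2 * p * s) * profileKernel h p (y - s)) = 0 := by
  have h0 : ∀ s ∈ Iic l₀, ENNReal.ofReal (2 * p * exp (2 * p * s) * profileKernel h p (y - s)) = 0 := by
    intro s hs
    rw [hh.profileKernel_eq_zero_of_ge p (by rw [mem_Iic] at hs; linarith), mul_zero, ENNReal.ofReal_zero]
  rw [setLIntegral_congr_fun measurableSet_Iic h0, lintegral_zero]

/-- **`Q(y) ≥ e^{2p(y-ε)}` below the level**: for `y + ε ≤ λ₀` the whole window `|y - s| ≤ ε`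
lies inside `s ≤ λ₀`. [cite: Chirka1989, §15.1 (∗)] -/
theorem exp_sub_le_lintegral_Iic_weight_mul_kernel (hh : IsProfileTransition h 0 ε) (hp : 1 ≤ p)
    (hε : 0 < ε) {l₀ y : ℝ} (hy : y + ε ≤ l₀) :
    ENNReal.ofReal (exp (2 * p * (y - ε))) ≤
      ∫⁻ s in Iic l₀, ENNReal.ofReal (2 * p * exp (2 * p * s) * profileKernel h p (y - s)) := by
  have hk := two_mul_pos hp
  calc ENNReal.ofReal (exp (2 * p * (y - ε)))
      = ENNReal.ofReal (2 * p * exp (2 * p * (y - ε))) * ENNReal.ofReal (1 / (2 * p)) := by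
        rw [← ENNReal.ofReal_mul (by positivity)]
        congr 1
        field_simp
    _ = ∫⁻ s in Icc (y - ε) (y + ε),
          ENNReal.ofReal (2 * p * exp (2 * p * (y - ε))) * ENNReal.ofReal (profileKernel h p (y - s)) := by
        rw [lintegral_const_mul' _ _ ENNReal.ofReal_ne_top, lintegral_Icc_kernel_eq_inv hh hp hε]
    _ ≤ ∫⁻ s in Icc (y - ε) (y + ε),
          ENNReal.ofReal (2 * p * exp (2 * p * s) * profileKernel h p (y - s)) := by
        refine setLIntegral_mono' measurableSet_Icc fun s hs => ?_
        rw [← ENNReal.ofReal_mul (by positivity)]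
        refine ENNReal.ofReal_le_ofReal (mul_le_mul_of_nonneg_right ?_ (hh.profileKernel_nonneg p _))
        exact mul_le_mul_of_nonneg_left (exp_le_exp.2 (by nlinarith [hs.1])) hk.le
    _ ≤ ∫⁻ s in Iic l₀, ENNReal.ofReal (2 * p * exp (2 * p * s) * profileKernel h p (y - s)) :=
        lintegral_mono_set fun s hs => show s ≤ l₀ by linarith [hs.2]

end Inner

variable [MeasurableSpace X] {μ : Measure X}

/-! ### Tonelli: the weighted hypothesis, integrated over the translates -/

section Main

variable {h : ℝ → ℝ} {ε : ℝ}

/-- **The integrated hypothesis.** For a transition `h` at `0` of scale `ε` and a level `λ₀` with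
`λ₀ + ε ≤ x₀`, integrating the profile identities of the translates `h(· - s)`, `s ≤ λ₀`, against
`2p e^{2ps} ds` gives, by Tonelli,
`∫ (rad^{-2p}(1-σ) P(log rad) + rad^{-2p} σ Q(log rad)) dμ = e^{2pλ₀} L` with
`P(y) = ∫_{s ≤ λ₀} 2p e^{2ps} h(y-s)^p ds`, `Q(y) = ∫_{s ≤ λ₀} 2p e^{2ps} ½h^{p-1}h'(y-s) ds`.
[cite: Chirka1989, §15.1 (∗)] -/
theorem lintegral_inner_eq_exp_mul_of_profile_invariance [SFinite μ] (hradm : Measurable rad)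
    (hrad : ∀ x, 0 < rad x) (hσm : Measurable σ) (hσ0 : ∀ x, 0 ≤ σ x) (hσ1 : ∀ x, σ x ≤ 1)
    (hp : 1 ≤ p)
    (H : ∀ (h : ℝ → ℝ) (s ε : ℝ), 0 < ε → s + ε ≤ x₀ → IsProfileTransition h s ε →
      ∫⁻ x, ENNReal.ofReal ((rad x ^ (2 * p))⁻¹ *
        (h (log (rad x)) ^ p * (1 - σ x) + profileKernel h p (log (rad x)) * σ x)) ∂μ = L)
    (hh : IsProfileTransition h 0 ε) (hε : 0 < ε) {l₀ : ℝ} (hl₀ : l₀ + ε ≤ x₀) :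
    ∫⁻ x, (ENNReal.ofReal ((rad x ^ (2 * p))⁻¹ * (1 - σ x)) *
        (∫⁻ s in Iic l₀, ENNReal.ofReal (2 * p * exp (2 * p * s) * h (log (rad x) - s) ^ p)) +
      ENNReal.ofReal ((rad x ^ (2 * p))⁻¹ * σ x) *
        (∫⁻ s in Iic l₀, ENNReal.ofReal (2 * p * exp (2 * p * s) * profileKernel h p (log (rad x) - s)))) ∂μ =
      ENNReal.ofReal (exp (2 * p * l₀)) * L := by
  have hk := two_mul_pos hp
  -- the hypothesis for the translates
  have Hs : ∀ s ∈ Iic l₀, ∫⁻ x, ENNReal.ofReal ((rad x ^ (2 * p))⁻¹ *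
      (h (log (rad x) - s) ^ p * (1 - σ x) + profileKernel h p (log (rad x) - s) * σ x)) ∂μ = L := by
    intro s hs
    have := H (fun y => h (y - s)) s ε hε (by rw [mem_Iic] at hs; linarith) (hh.translate s)
    simpa only [hh.profileKernel_comp_sub] using this
  -- the weighted integrand on `ℝ × X`
  set F : ℝ → X → ℝ≥0∞ := fun s x => ENNReal.ofReal (2 * p * exp (2 * p * s)) *
    ENNReal.ofReal ((rad x ^ (2 * p))⁻¹ *
      (h (log (rad x) - s) ^ p * (1 - σ x) + profileKernel h p (log (rad x) - s) * σ x)) with hF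
  have hwm : Measurable fun s : ℝ => ENNReal.ofReal (2 * p * exp (2 * p * s)) :=
    ENNReal.measurable_ofReal.comp (by fun_prop)
  have hmeas : Measurable (Function.uncurry F) := by
    refine (hwm.comp measurable_fst).mul (ENNReal.measurable_ofReal.comp ?_)
    have hr : Measurable fun z : ℝ × X => rad z.2 := hradm.comp measurable_snd
    have hσ' : Measurable fun z : ℝ × X => σ z.2 := hσm.comp measurable_snd
    have ht : Measurable fun z : ℝ × X => log (rad z.2) - z.1 := (measurable_log.comp hr).sub measurable_fst
    exact ((hr.pow_const _).inv).mul
      ((((hh.contDiff.continuous.measurable.comp ht).pow_const _).mul (measurable_const.sub hσ')).add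
        (((hh.continuous_profileKernel p).measurable.comp ht).mul hσ'))
  -- total: `∫_{s ≤ λ₀} 2p e^{2ps} L ds = e^{2pλ₀} L`
  have htot : ∫⁻ s in Iic l₀, ∫⁻ x, F s x ∂μ = ENNReal.ofReal (exp (2 * p * l₀)) * L := by
    have hs : ∀ s ∈ Iic l₀, ∫⁻ x, F s x ∂μ = ENNReal.ofReal (2 * p * exp (2 * p * s)) * L := by
      intro s hs
      simp only [hF]
      rw [lintegral_const_mul' _ _ ENNReal.ofReal_ne_top, Hs s hs]
    rw [setLIntegral_congr_fun measurableSet_Iic hs, lintegral_mul_const _ hwm,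
      lintegral_Iic_mul_exp hk l₀]
  -- Tonelli
  have hswap : ∫⁻ s in Iic l₀, ∫⁻ x, F s x ∂μ = ∫⁻ x, (∫⁻ s in Iic l₀, F s x) ∂μ :=
    lintegral_lintegral_swap hmeas.aemeasurable
  -- the inner integral, pointwise in `x`
  have hinner : ∀ x, ∫⁻ s in Iic l₀, F s x =
      ENNReal.ofReal ((rad x ^ (2 * p))⁻¹ * (1 - σ x)) *
        (∫⁻ s in Iic l₀, ENNReal.ofReal (2 * p * exp (2 * p * s) * h (log (rad x) - s) ^ p)) +
      ENNReal.ofReal ((rad x ^ (2 * p))⁻¹ * σ x) *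
        (∫⁻ s in Iic l₀, ENNReal.ofReal (2 * p * exp (2 * p * s) * profileKernel h p (log (rad x) - s))) := by
    intro x
    have hc0 : 0 ≤ (rad x ^ (2 * p))⁻¹ := inv_nonneg.2 (pow_nonneg (hrad x).le _)
    have hc1 : 0 ≤ (rad x ^ (2 * p))⁻¹ * (1 - σ x) := mul_nonneg hc0 (by linarith [hσ1 x])
    have hc2 : 0 ≤ (rad x ^ (2 * p))⁻¹ * σ x := mul_nonneg hc0 (hσ0 x)
    have hpt : ∀ s, F s x =
        ENNReal.ofReal ((rad x ^ (2 * p))⁻¹ * (1 - σ x)) *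
          ENNReal.ofReal (2 * p * exp (2 * p * s) * h (log (rad x) - s) ^ p) +
        ENNReal.ofReal ((rad x ^ (2 * p))⁻¹ * σ x) *
          ENNReal.ofReal (2 * p * exp (2 * p * s) * profileKernel h p (log (rad x) - s)) := by
      intro s
      have hw0 : 0 ≤ 2 * p * exp (2 * p * s) := by positivity
      have hhp : 0 ≤ h (log (rad x) - s) ^ p := pow_nonneg (hh.nonneg _) _
      have hK : 0 ≤ profileKernel h p (log (rad x) - s) := hh.profileKernel_nonneg p _
      simp only [hF]
      rw [mul_add, ENNReal.ofReal_add (mul_nonneg hc0 (mul_nonneg hhp (by linarith [hσ1 x])))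
        (mul_nonneg hc0 (mul_nonneg hK (hσ0 x))), mul_add, ← ENNReal.ofReal_mul hw0,
        ← ENNReal.ofReal_mul hw0, ← ENNReal.ofReal_mul hc1, ← ENNReal.ofReal_mul hc2]
      congr 2 <;> ring
    have hfun : (fun s => F s x) = fun s =>
        ENNReal.ofReal ((rad x ^ (2 * p))⁻¹ * (1 - σ x)) *
          ENNReal.ofReal (2 * p * exp (2 * p * s) * h (log (rad x) - s) ^ p) +
        ENNReal.ofReal ((rad x ^ (2 * p))⁻¹ * σ x) *
          ENNReal.ofReal (2 * p * exp (2 * p * s) * profileKernel h p (log (rad x) - s)) := funext hpt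
    have hm1 : Measurable fun s : ℝ => ENNReal.ofReal (2 * p * exp (2 * p * s) * h (log (rad x) - s) ^ p) :=
      ENNReal.measurable_ofReal.comp ((by fun_prop : Measurable fun s : ℝ => 2 * p * exp (2 * p * s)).mul
        ((hh.contDiff.continuous.measurable.comp (measurable_const.sub measurable_id)).pow_const _))
    have hm2 : Measurable fun s : ℝ =>
        ENNReal.ofReal (2 * p * exp (2 * p * s) * profileKernel h p (log (rad x) - s)) :=
      ENNReal.measurable_ofReal.comp ((by fun_prop : Measurable fun s : ℝ => 2 * p * exp (2 * p * s)).mul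
        ((hh.continuous_profileKernel p).measurable.comp (measurable_const.sub measurable_id)))
    rw [hfun, lintegral_add_left (hm1.const_mul _), lintegral_const_mul _ hm1, lintegral_const_mul _ hm2]
  calc _ = ∫⁻ x, (∫⁻ s in Iic l₀, F s x) ∂μ := lintegral_congr fun x => (hinner x).symm
    _ = ∫⁻ s in Iic l₀, ∫⁻ x, F s x ∂μ := hswap.symm
    _ = ENNReal.ofReal (exp (2 * p * l₀)) * L := htot

/-- **Upper window bound**: with `h`, `ε`, `λ₀` as above,
`e^{2pλ₀} L ≤ e^{2pε} μ{log rad < λ₀ + ε} + e^{2pλ₀} ∫_{log rad ≥ λ₀ + ε} rad^{-2p}(1 - σ) dμ`.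
[cite: Chirka1989, §15.1 (∗)] -/
theorem exp_mul_le_measure_add_of_profile_invariance [SFinite μ] (hradm : Measurable rad)
    (hrad : ∀ x, 0 < rad x) (hσm : Measurable σ) (hσ0 : ∀ x, 0 ≤ σ x) (hσ1 : ∀ x, σ x ≤ 1)
    (hp : 1 ≤ p)
    (H : ∀ (h : ℝ → ℝ) (s ε : ℝ), 0 < ε → s + ε ≤ x₀ → IsProfileTransition h s ε →
      ∫⁻ x, ENNReal.ofReal ((rad x ^ (2 * p))⁻¹ *
        (h (log (rad x)) ^ p * (1 - σ x) + profileKernel h p (log (rad x)) * σ x)) ∂μ = L)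
    (hh : IsProfileTransition h 0 ε) (hε : 0 < ε) {l₀ : ℝ} (hl₀ : l₀ + ε ≤ x₀) :
    ENNReal.ofReal (exp (2 * p * l₀)) * L ≤
      ENNReal.ofReal (exp (2 * p * ε)) * μ {x | log (rad x) < l₀ + ε} +
        ENNReal.ofReal (exp (2 * p * l₀)) *
          ∫⁻ x in {x | l₀ + ε ≤ log (rad x)}, ENNReal.ofReal ((rad x ^ (2 * p))⁻¹ * (1 - σ x)) ∂μ := by
  rw [← lintegral_inner_eq_exp_mul_of_profile_invariance hradm hrad hσm hσ0 hσ1 hp H hh hε hl₀]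
  -- the majorant
  set g : X → ℝ≥0∞ := fun x => {x | log (rad x) < l₀ + ε}.indicator (fun _ => ENNReal.ofReal (exp (2 * p * ε))) x +
    {x | l₀ + ε ≤ log (rad x)}.indicator
      (fun x => ENNReal.ofReal (exp (2 * p * l₀)) * ENNReal.ofReal ((rad x ^ (2 * p))⁻¹ * (1 - σ x))) x
    with hg
  have hint : ∫⁻ x, g x ∂μ = ENNReal.ofReal (exp (2 * p * ε)) * μ {x | log (rad x) < l₀ + ε} +
      ENNReal.ofReal (exp (2 * p * l₀)) *
        ∫⁻ x in {x | l₀ + ε ≤ log (rad x)}, ENNReal.ofReal ((rad x ^ (2 * p))⁻¹ * (1 - σ x)) ∂μ := by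
    simp only [hg]
    rw [lintegral_add_left ((measurable_const.indicator (measurableSet_log_lt hradm _))),
      lintegral_indicator (measurableSet_log_lt hradm _), setLIntegral_const,
      lintegral_indicator (measurableSet_le_log hradm _),
      lintegral_const_mul _ (measurable_inv_pow_mul_one_sub hradm hσm)]
  rw [← hint]
  refine lintegral_mono fun x => ?_
  have hc0 : 0 ≤ (rad x ^ (2 * p))⁻¹ := inv_nonneg.2 (pow_nonneg (hrad x).le _)
  have hc1 : 0 ≤ (rad x ^ (2 * p))⁻¹ * (1 - σ x) := mul_nonneg hc0 (by linarith [hσ1 x])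
  have hc2 : 0 ≤ (rad x ^ (2 * p))⁻¹ * σ x := mul_nonneg hc0 (hσ0 x)
  have hsum : (rad x ^ (2 * p))⁻¹ * (1 - σ x) + (rad x ^ (2 * p))⁻¹ * σ x = (rad x ^ (2 * p))⁻¹ := by ring
  by_cases hx : log (rad x) < l₀ + ε
  · have hgx : g x = ENNReal.ofReal (exp (2 * p * ε)) := by
      simp only [hg]
      rw [indicator_of_mem (show x ∈ {x | log (rad x) < l₀ + ε} from hx),
        indicator_of_notMem (show x ∉ {x | l₀ + ε ≤ log (rad x)} from fun h' => absurd hx (not_lt.2 h')),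
        add_zero]
    rw [hgx]
    calc _ ≤ ENNReal.ofReal ((rad x ^ (2 * p))⁻¹ * (1 - σ x)) * ENNReal.ofReal (exp (2 * p * (log (rad x) + ε))) +
          ENNReal.ofReal ((rad x ^ (2 * p))⁻¹ * σ x) * ENNReal.ofReal (exp (2 * p * (log (rad x) + ε))) :=
          add_le_add (mul_le_mul_right (lintegral_Iic_weight_mul_pow_le_exp_add hh hp l₀ _) _)
            (mul_le_mul_right (lintegral_Iic_weight_mul_kernel_le_exp_add hh hp hε l₀ _) _)
      _ = ENNReal.ofReal (exp (2 * p * ε)) := by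
          rw [← add_mul, ← ENNReal.ofReal_add hc1 hc2, hsum, ← ENNReal.ofReal_mul hc0,
            inv_pow_mul_exp_log_add (hrad x)]
  · have hx' : l₀ + ε ≤ log (rad x) := not_lt.1 hx
    have hgx : g x = ENNReal.ofReal (exp (2 * p * l₀)) * ENNReal.ofReal ((rad x ^ (2 * p))⁻¹ * (1 - σ x)) := by
      simp only [hg]
      rw [indicator_of_notMem (show x ∉ {x | log (rad x) < l₀ + ε} from hx),
        indicator_of_mem (show x ∈ {x | l₀ + ε ≤ log (rad x)} from hx'), zero_add]
    rw [hgx, lintegral_Iic_weight_mul_kernel_eq_zero_of_le hh (by linarith), mul_zero, add_zero, mul_comm]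
    exact mul_le_mul_left (lintegral_Iic_weight_mul_pow_le_exp hh hp l₀ _) _

/-- **Lower window bound**: with `h`, `ε`, `λ₀` as above,
`e^{-2pε} μ{log rad ≤ λ₀ - ε} + e^{2pλ₀} ∫_{log rad ≥ λ₀ + ε} rad^{-2p}(1 - σ) dμ ≤ e^{2pλ₀} L`.
[cite: Chirka1989, §15.1 (∗)] -/
theorem measure_add_le_exp_mul_of_profile_invariance [SFinite μ] (hradm : Measurable rad)
    (hrad : ∀ x, 0 < rad x) (hσm : Measurable σ) (hσ0 : ∀ x, 0 ≤ σ x) (hσ1 : ∀ x, σ x ≤ 1)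
    (hp : 1 ≤ p)
    (H : ∀ (h : ℝ → ℝ) (s ε : ℝ), 0 < ε → s + ε ≤ x₀ → IsProfileTransition h s ε →
      ∫⁻ x, ENNReal.ofReal ((rad x ^ (2 * p))⁻¹ *
        (h (log (rad x)) ^ p * (1 - σ x) + profileKernel h p (log (rad x)) * σ x)) ∂μ = L)
    (hh : IsProfileTransition h 0 ε) (hε : 0 < ε) {l₀ : ℝ} (hl₀ : l₀ + ε ≤ x₀) :
    ENNReal.ofReal (exp (-(2 * p * ε))) * μ {x | log (rad x) ≤ l₀ - ε} +
        ENNReal.ofReal (exp (2 * p * l₀)) *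
          ∫⁻ x in {x | l₀ + ε ≤ log (rad x)}, ENNReal.ofReal ((rad x ^ (2 * p))⁻¹ * (1 - σ x)) ∂μ ≤
      ENNReal.ofReal (exp (2 * p * l₀)) * L := by
  rw [← lintegral_inner_eq_exp_mul_of_profile_invariance hradm hrad hσm hσ0 hσ1 hp H hh hε hl₀]
  -- the minorant
  set g : X → ℝ≥0∞ := fun x => {x | log (rad x) ≤ l₀ - ε}.indicator (fun _ => ENNReal.ofReal (exp (-(2 * p * ε)))) x +
    {x | l₀ + ε ≤ log (rad x)}.indicator
      (fun x => ENNReal.ofReal (exp (2 * p * l₀)) * ENNReal.ofReal ((rad x ^ (2 * p))⁻¹ * (1 - σ x))) x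
    with hg
  have hint : ∫⁻ x, g x ∂μ = ENNReal.ofReal (exp (-(2 * p * ε))) * μ {x | log (rad x) ≤ l₀ - ε} +
      ENNReal.ofReal (exp (2 * p * l₀)) *
        ∫⁻ x in {x | l₀ + ε ≤ log (rad x)}, ENNReal.ofReal ((rad x ^ (2 * p))⁻¹ * (1 - σ x)) ∂μ := by
    simp only [hg]
    rw [lintegral_add_left ((measurable_const.indicator (measurableSet_log_le hradm _))),
      lintegral_indicator (measurableSet_log_le hradm _), setLIntegral_const,
      lintegral_indicator (measurableSet_le_log hradm _),
      lintegral_const_mul _ (measurable_inv_pow_mul_one_sub hradm hσm)]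
  rw [← hint]
  refine lintegral_mono fun x => ?_
  have hc0 : 0 ≤ (rad x ^ (2 * p))⁻¹ := inv_nonneg.2 (pow_nonneg (hrad x).le _)
  have hc1 : 0 ≤ (rad x ^ (2 * p))⁻¹ * (1 - σ x) := mul_nonneg hc0 (by linarith [hσ1 x])
  have hc2 : 0 ≤ (rad x ^ (2 * p))⁻¹ * σ x := mul_nonneg hc0 (hσ0 x)
  have hsum : (rad x ^ (2 * p))⁻¹ * (1 - σ x) + (rad x ^ (2 * p))⁻¹ * σ x = (rad x ^ (2 * p))⁻¹ := by ring
  by_cases h1 : log (rad x) ≤ l₀ - ε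
  · have h2 : ¬ l₀ + ε ≤ log (rad x) := fun h2 => by linarith
    have hgx : g x = ENNReal.ofReal (exp (-(2 * p * ε))) := by
      simp only [hg]
      rw [indicator_of_mem (show x ∈ {x | log (rad x) ≤ l₀ - ε} from h1),
        indicator_of_notMem (show x ∉ {x | l₀ + ε ≤ log (rad x)} from h2), add_zero]
    rw [hgx]
    calc ENNReal.ofReal (exp (-(2 * p * ε)))
        = ENNReal.ofReal ((rad x ^ (2 * p))⁻¹ * (1 - σ x)) * ENNReal.ofReal (exp (2 * p * (log (rad x) - ε))) +
          ENNReal.ofReal ((rad x ^ (2 * p))⁻¹ * σ x) * ENNReal.ofReal (exp (2 * p * (log (rad x) - ε))) := by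
          rw [← add_mul, ← ENNReal.ofReal_add hc1 hc2, hsum, ← ENNReal.ofReal_mul hc0, sub_eq_add_neg,
            inv_pow_mul_exp_log_add (hrad x), mul_neg]
      _ ≤ _ := add_le_add
          (mul_le_mul_right (exp_sub_le_lintegral_Iic_weight_mul_pow hh hp (by linarith)) _)
          (mul_le_mul_right (exp_sub_le_lintegral_Iic_weight_mul_kernel hh hp hε (by linarith)) _)
  · by_cases h2 : l₀ + ε ≤ log (rad x)
    · have hgx : g x = ENNReal.ofReal (exp (2 * p * l₀)) * ENNReal.ofReal ((rad x ^ (2 * p))⁻¹ * (1 - σ x)) := by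
        simp only [hg]
        rw [indicator_of_notMem (show x ∉ {x | log (rad x) ≤ l₀ - ε} from h1),
          indicator_of_mem (show x ∈ {x | l₀ + ε ≤ log (rad x)} from h2), zero_add]
      rw [hgx, mul_comm]
      exact le_add_right (mul_le_mul_right
        (lintegral_Iic_weight_mul_pow_eq_exp_of_le hh hp (by linarith : l₀ ≤ log (rad x) - ε)).symm.le _)
    · have hgx : g x = 0 := by
        simp only [hg]
        rw [indicator_of_notMem (show x ∉ {x | log (rad x) ≤ l₀ - ε} from h1),
          indicator_of_notMem (show x ∉ {x | l₀ + ε ≤ log (rad x)} from h2), add_zero]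
      rw [hgx]
      exact bot_le

/-- **The Lelong–Jensen identity at the level `x ≤ x₀`** (logarithmic form):
`μ{log rad < x} + e^{2px} ∫_{log rad ≥ x} rad^{-2p}(1 - σ) dμ = e^{2px} L`.
[cite: Chirka1989, §15.1 (∗)] -/
theorem measure_log_lt_add_eq_of_profile_invariance [SFinite μ] (hradm : Measurable rad)
    (hrad : ∀ x, 0 < rad x) (hσm : Measurable σ) (hσ0 : ∀ x, 0 ≤ σ x) (hσ1 : ∀ x, σ x ≤ 1)
    (hp : 1 ≤ p)
    (H : ∀ (h : ℝ → ℝ) (s ε : ℝ), 0 < ε → s + ε ≤ x₀ → IsProfileTransition h s ε →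
      ∫⁻ x, ENNReal.ofReal ((rad x ^ (2 * p))⁻¹ *
        (h (log (rad x)) ^ p * (1 - σ x) + profileKernel h p (log (rad x)) * σ x)) ∂μ = L)
    {x : ℝ} (hx : x ≤ x₀) :
    μ {y | log (rad y) < x} +
        ENNReal.ofReal (exp (2 * p * x)) *
          ∫⁻ y in {y | x ≤ log (rad y)}, ENNReal.ofReal ((rad y ^ (2 * p))⁻¹ * (1 - σ y)) ∂μ =
      ENNReal.ofReal (exp (2 * p * x)) * L := by
  set A := ∫⁻ y in {y | x ≤ log (rad y)}, ENNReal.ofReal ((rad y ^ (2 * p))⁻¹ * (1 - σ y)) ∂μ with hA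
  set F := μ {y | log (rad y) < x} with hFdef
  -- the two bounds at scale `ε`, level `λ₀ = x - ε`, after multiplication by `e^{2pε}`
  have hUB : ∀ ε, 0 < ε → ENNReal.ofReal (exp (2 * p * x)) * L ≤
      ENNReal.ofReal (exp ((4 * p) * ε)) * F + ENNReal.ofReal (exp (2 * p * x)) * A := by
    intro ε hε
    obtain ⟨h, hh⟩ := exists_isProfileTransition 0 hε
    have hb := exp_mul_le_measure_add_of_profile_invariance hradm hrad hσm hσ0 hσ1 hp H hh hε
      (l₀ := x - ε) (by linarith)
    simp only [sub_add_cancel] at hb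
    have hb' := mul_le_mul_right hb (ENNReal.ofReal (exp (2 * p * ε)))
    have e1 : ENNReal.ofReal (exp (2 * p * ε)) * (ENNReal.ofReal (exp (2 * p * (x - ε))) * L) =
        ENNReal.ofReal (exp (2 * p * x)) * L := by
      rw [← mul_assoc, ← ENNReal.ofReal_mul (exp_pos _).le, ← exp_add]; ring_nf
    have e2 : ENNReal.ofReal (exp (2 * p * ε)) * (ENNReal.ofReal (exp (2 * p * ε)) * F +
        ENNReal.ofReal (exp (2 * p * (x - ε))) * A) =
        ENNReal.ofReal (exp ((4 * p) * ε)) * F + ENNReal.ofReal (exp (2 * p * x)) * A := by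
      rw [mul_add, ← mul_assoc, ← mul_assoc, ← ENNReal.ofReal_mul (exp_pos _).le,
        ← ENNReal.ofReal_mul (exp_pos _).le, ← exp_add, ← exp_add]; ring_nf
    rwa [e1, e2] at hb'
  have hLB : ∀ ε, 0 < ε → μ {y | log (rad y) ≤ x - 2 * ε} + ENNReal.ofReal (exp (2 * p * x)) * A ≤
      ENNReal.ofReal (exp (2 * p * x)) * L := by
    intro ε hε
    obtain ⟨h, hh⟩ := exists_isProfileTransition 0 hε
    have hb := measure_add_le_exp_mul_of_profile_invariance hradm hrad hσm hσ0 hσ1 hp H hh hε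
      (l₀ := x - ε) (by linarith)
    simp only [sub_add_cancel] at hb
    have hb' := mul_le_mul_right hb (ENNReal.ofReal (exp (2 * p * ε)))
    have e1 : ENNReal.ofReal (exp (2 * p * ε)) * (ENNReal.ofReal (exp (2 * p * (x - ε))) * L) =
        ENNReal.ofReal (exp (2 * p * x)) * L := by
      rw [← mul_assoc, ← ENNReal.ofReal_mul (exp_pos _).le, ← exp_add]; ring_nf
    have e2 : ENNReal.ofReal (exp (2 * p * ε)) * (ENNReal.ofReal (exp (-(2 * p * ε))) *
        μ {y | log (rad y) ≤ x - ε - ε} + ENNReal.ofReal (exp (2 * p * (x - ε))) * A) =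
        μ {y | log (rad y) ≤ x - 2 * ε} + ENNReal.ofReal (exp (2 * p * x)) * A := by
      rw [mul_add, ← mul_assoc, ← mul_assoc, ← ENNReal.ofReal_mul (exp_pos _).le,
        ← ENNReal.ofReal_mul (exp_pos _).le, ← exp_add, ← exp_add, add_neg_cancel, exp_zero,
        ENNReal.ofReal_one, one_mul, show x - ε - ε = x - 2 * ε by ring]
      ring_nf
    rwa [e1, e2] at hb'
  apply le_antisymm
  · -- from the lower bounds, by continuity of `μ` from below along `ε = 1/(n+1)`
    have hmono : Monotone fun n : ℕ => {y : X | log (rad y) ≤ x - 2 * (1 / ((n : ℝ) + 1))} := by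
      intro n m hnm y hy
      simp only [mem_setOf_eq] at hy ⊢
      have h1 : (1 : ℝ) / ((m : ℝ) + 1) ≤ 1 / ((n : ℝ) + 1) := by
        gcongr
      linarith
    have hU : (⋃ n : ℕ, {y : X | log (rad y) ≤ x - 2 * (1 / ((n : ℝ) + 1))}) = {y | log (rad y) < x} := by
      ext y
      simp only [mem_iUnion, mem_setOf_eq]
      constructor
      · rintro ⟨n, hn⟩
        have : (0 : ℝ) < 1 / ((n : ℝ) + 1) := by positivity
        linarith
      · intro hy
        obtain ⟨n, hn⟩ := exists_nat_gt (2 / (x - log (rad y)))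
        refine ⟨n, ?_⟩
        have hpos : 0 < x - log (rad y) := by linarith
        have hn' : 2 / (x - log (rad y)) < (n : ℝ) + 1 := by linarith
        rw [div_lt_iff₀ hpos] at hn'
        have : 2 * (1 / ((n : ℝ) + 1)) ≤ x - log (rad y) := by
          rw [mul_one_div, div_le_iff₀ (by positivity)]; linarith
        linarith
    have hlim := tendsto_measure_iUnion_atTop (μ := μ) hmono
    rw [hU] at hlim
    exact le_of_tendsto' (hlim.add_const (ENNReal.ofReal (exp (2 * p * x)) * A)) fun n =>
      hLB _ (by positivity)
  · -- from the upper bounds, letting `ε → 0⁺`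
    have hlim : Tendsto (fun ε : ℝ => ENNReal.ofReal (exp ((4 * p) * ε)) * F +
        ENNReal.ofReal (exp (2 * p * x)) * A) (𝓝[>] 0) (𝓝 (F + ENNReal.ofReal (exp (2 * p * x)) * A)) := by
      have h1 := ENNReal.Tendsto.mul_const (tendsto_ofReal_exp_mul_nhdsGT ((4 : ℝ) * p)) (Or.inl one_ne_zero)
        (b := F)
      rw [one_mul] at h1
      exact h1.add_const _
    exact ge_of_tendsto hlim (eventually_nhdsWithin_of_forall fun ε hε => hUB ε hε)

end Main

/-! ### The identity and its consequences in terms of the radius -/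

section Radius

/-- **The Lelong–Jensen identity.** Under the profile-invariance hypothesis (as in
`tendsto_measure_div_pow_of_profile_invariance`), for every `0 < r ≤ e^{x₀}`:
`μ{rad < r} + r^{2p} ∫_{rad ≥ r} rad^{-2p}(1 - σ) dμ = r^{2p} L`. For `μ = 𝓗^{2p} ⌞ A` this is
Chirka's formula `vol A_r = n c(p) r^{2p} + r^{2p} ∫_{A_r} ω₀ᵖ/p!`. [cite: Chirka1989, §15.1 (∗)] -/
theorem measure_lt_add_mul_setLIntegral_eq_of_profile_invariance [SFinite μ] (hradm : Measurable rad)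
    (hrad : ∀ x, 0 < rad x) (hσm : Measurable σ) (hσ0 : ∀ x, 0 ≤ σ x) (hσ1 : ∀ x, σ x ≤ 1)
    (hp : 1 ≤ p)
    (H : ∀ (h : ℝ → ℝ) (s ε : ℝ), 0 < ε → s + ε ≤ x₀ → IsProfileTransition h s ε →
      ∫⁻ x, ENNReal.ofReal ((rad x ^ (2 * p))⁻¹ *
        (h (log (rad x)) ^ p * (1 - σ x) + profileKernel h p (log (rad x)) * σ x)) ∂μ = L)
    {r : ℝ} (hr : 0 < r) (hrx : log r ≤ x₀) :
    μ {x | rad x < r} +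
        ENNReal.ofReal (r ^ (2 * p)) *
          ∫⁻ x in {x | r ≤ rad x}, ENNReal.ofReal ((rad x ^ (2 * p))⁻¹ * (1 - σ x)) ∂μ =
      ENNReal.ofReal (r ^ (2 * p)) * L := by
  have hmain := measure_log_lt_add_eq_of_profile_invariance hradm hrad hσm hσ0 hσ1 hp H hrx
  have hexp : exp (2 * p * log r) = r ^ (2 * p) := by
    have := exp_two_mul_log_add (p := p) hr 0
    rwa [add_zero, mul_zero, exp_zero, mul_one] at this
  have hs1 : {x | log (rad x) < log r} = {x | rad x < r} := by
    ext x; exact log_lt_log_iff (hrad x) hr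
  have hs2 : {x | log r ≤ log (rad x)} = {x | r ≤ rad x} := by
    ext x; exact log_le_log_iff hr (hrad x)
  rwa [hexp, hs1, hs2] at hmain

/-- The tail integral is at most `L`, hence finite. [cite: Chirka1989, §15.1 (∗)] -/
theorem setLIntegral_inv_pow_mul_one_sub_le_of_profile_invariance (hradm : Measurable rad)
    (hrad : ∀ x, 0 < rad x) (hσm : Measurable σ) (hσ0 : ∀ x, 0 ≤ σ x) (hσ1 : ∀ x, σ x ≤ 1)
    (H : ∀ (h : ℝ → ℝ) (s ε : ℝ), 0 < ε → s + ε ≤ x₀ → IsProfileTransition h s ε →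
      ∫⁻ x, ENNReal.ofReal ((rad x ^ (2 * p))⁻¹ *
        (h (log (rad x)) ^ p * (1 - σ x) + profileKernel h p (log (rad x)) * σ x)) ∂μ = L)
    (S : Set X) :
    ∫⁻ x in S, ENNReal.ofReal ((rad x ^ (2 * p))⁻¹ * (1 - σ x)) ∂μ ≤ L :=
  (lintegral_mono' Measure.restrict_le_self le_rfl).trans
    (lintegral_inv_pow_mul_one_sub_le hradm hrad hσm hσ0 hσ1 H)

/-- **The mass ratio, exactly**: for `0 < r ≤ e^{x₀}`,
`μ{rad < r} / r^{2p} = L - ∫_{rad ≥ r} rad^{-2p}(1 - σ) dμ`. [cite: Chirka1989, §15.1 (∗)] -/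
theorem measure_lt_div_pow_eq_of_profile_invariance [SFinite μ] (hradm : Measurable rad)
    (hrad : ∀ x, 0 < rad x) (hσm : Measurable σ) (hσ0 : ∀ x, 0 ≤ σ x) (hσ1 : ∀ x, σ x ≤ 1)
    (hp : 1 ≤ p) (hL : L ≠ ⊤)
    (H : ∀ (h : ℝ → ℝ) (s ε : ℝ), 0 < ε → s + ε ≤ x₀ → IsProfileTransition h s ε →
      ∫⁻ x, ENNReal.ofReal ((rad x ^ (2 * p))⁻¹ *
        (h (log (rad x)) ^ p * (1 - σ x) + profileKernel h p (log (rad x)) * σ x)) ∂μ = L)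
    {r : ℝ} (hr : 0 < r) (hrx : log r ≤ x₀) :
    μ {x | rad x < r} / ENNReal.ofReal (r ^ (2 * p)) =
      L - ∫⁻ x in {x | r ≤ rad x}, ENNReal.ofReal ((rad x ^ (2 * p))⁻¹ * (1 - σ x)) ∂μ := by
  set A := ∫⁻ x in {x | r ≤ rad x}, ENNReal.ofReal ((rad x ^ (2 * p))⁻¹ * (1 - σ x)) ∂μ with hA
  have hmain := measure_lt_add_mul_setLIntegral_eq_of_profile_invariance hradm hrad hσm hσ0 hσ1 hp H hr hrx
  have hAL : A ≤ L := setLIntegral_inv_pow_mul_one_sub_le_of_profile_invariance hradm hrad hσm hσ0 hσ1 H _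
  have hb0 : ENNReal.ofReal (r ^ (2 * p)) ≠ 0 := (ENNReal.ofReal_pos.2 (pow_pos hr _)).ne'
  have hbt : ENNReal.ofReal (r ^ (2 * p)) ≠ ⊤ := ENNReal.ofReal_ne_top
  have hAt : ENNReal.ofReal (r ^ (2 * p)) * A ≠ ⊤ := ENNReal.mul_ne_top hbt (ne_top_of_le_ne_top hL hAL)
  have heq : μ {x | rad x < r} = ENNReal.ofReal (r ^ (2 * p)) * (L - A) := by
    rw [ENNReal.mul_sub (fun _ _ => hbt)]
    exact ENNReal.eq_sub_of_add_eq hAt hmain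
  rw [heq, mul_comm, ENNReal.mul_div_cancel_right hb0 hbt]

/-- **The Lelong number bounds every mass ratio from below**: `L - W ≤ μ{rad < r}/r^{2p}` for
`0 < r ≤ e^{x₀}`, `W = ∫ rad^{-2p}(1 - σ) dμ` (so the limit of
`tendsto_measure_div_pow_of_profile_invariance` is an infimum). [cite: Chirka1989, §15.1 Prop. 1] -/
theorem sub_le_measure_lt_div_pow_of_profile_invariance [SFinite μ] (hradm : Measurable rad)
    (hrad : ∀ x, 0 < rad x) (hσm : Measurable σ) (hσ0 : ∀ x, 0 ≤ σ x) (hσ1 : ∀ x, σ x ≤ 1)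
    (hp : 1 ≤ p) (hL : L ≠ ⊤)
    (H : ∀ (h : ℝ → ℝ) (s ε : ℝ), 0 < ε → s + ε ≤ x₀ → IsProfileTransition h s ε →
      ∫⁻ x, ENNReal.ofReal ((rad x ^ (2 * p))⁻¹ *
        (h (log (rad x)) ^ p * (1 - σ x) + profileKernel h p (log (rad x)) * σ x)) ∂μ = L)
    {r : ℝ} (hr : 0 < r) (hrx : log r ≤ x₀) :
    L - ∫⁻ x, ENNReal.ofReal ((rad x ^ (2 * p))⁻¹ * (1 - σ x)) ∂μ ≤
      μ {x | rad x < r} / ENNReal.ofReal (r ^ (2 * p)) := by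
  rw [measure_lt_div_pow_eq_of_profile_invariance hradm hrad hσm hσ0 hσ1 hp hL H hr hrx]
  exact tsub_le_tsub_left (lintegral_mono' Measure.restrict_le_self le_rfl) L

/-- **Monotonicity of the mass ratio**: under the profile-invariance hypothesis the function
`r ↦ μ{rad < r}/r^{2p}` is monotone non-decreasing on `(0, e^{x₀}]`. For `μ = 𝓗^{2p} ⌞ A` this is
"the function `r^{-2p} vol_{2p} A_r` decreases monotone as `r → 0`" [Chirka1989, §15.1 Prop. 1].
[cite: Chirka1989, §15.1 Prop. 1] -/
theorem monotoneOn_measure_lt_div_pow_of_profile_invariance [SFinite μ] (hradm : Measurable rad)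
    (hrad : ∀ x, 0 < rad x) (hσm : Measurable σ) (hσ0 : ∀ x, 0 ≤ σ x) (hσ1 : ∀ x, σ x ≤ 1)
    (hp : 1 ≤ p) (hL : L ≠ ⊤)
    (H : ∀ (h : ℝ → ℝ) (s ε : ℝ), 0 < ε → s + ε ≤ x₀ → IsProfileTransition h s ε →
      ∫⁻ x, ENNReal.ofReal ((rad x ^ (2 * p))⁻¹ *
        (h (log (rad x)) ^ p * (1 - σ x) + profileKernel h p (log (rad x)) * σ x)) ∂μ = L) :
    MonotoneOn (fun r : ℝ => μ {x | rad x < r} / ENNReal.ofReal (r ^ (2 * p))) (Ioc 0 (exp x₀)) := by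
  intro r₁ hr₁ r₂ hr₂ h12
  have hx₁ : log r₁ ≤ x₀ := by rw [← log_exp x₀]; exact log_le_log hr₁.1 hr₁.2
  have hx₂ : log r₂ ≤ x₀ := by rw [← log_exp x₀]; exact log_le_log hr₂.1 hr₂.2
  simp only
  rw [measure_lt_div_pow_eq_of_profile_invariance hradm hrad hσm hσ0 hσ1 hp hL H hr₁.1 hx₁,
    measure_lt_div_pow_eq_of_profile_invariance hradm hrad hσm hσ0 hσ1 hp hL H hr₂.1 hx₂]
  exact tsub_le_tsub_left (lintegral_mono_set fun x (hx : r₂ ≤ rad x) => show r₁ ≤ rad x from h12.trans hx) L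

end Radius

end Literature.Geometry.GeometricMeasureTheory

end
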